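import Literature.NumberTheory.EllipticCurves.KolyvaginShaStructure
import Literature.NumberTheory.EllipticCurves.KolyvaginShaStructureIndexFormProofs
import Literature.NumberTheory.EllipticCurves.BSDSelmerCMPConverseHeegnerFieldProofs
import Literature.NumberTheory.EllipticCurves.BSDQuadraticDescentShaOddPartGeneralProofs
import Literature.NumberTheory.EllipticCurves.Rank1Residual.Typed.Basic
import Literature.NumberTheory.EllipticCurves.NonEisensteinPrimeOfSurjective
import Literature.NumberTheory.EllipticCurves.BSDRootNumberOddParityProofs
import Summits.BirchSwinnertonDyer.Rank1Residual.X11b.HeegnerPointScaling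
import HarnessLib

/-!
# The Heegner-INDEX form of the derived-point certificate: `ord_p [E(K) : ℤ y_K] = m₀` ⟺
# `p^{m₀} ∥ y_K` in `E(K)` (McCallum 1991 Lemma 5.1's bookkeeping, proved), and the index-form
# consumers of the Matar–Nekovář fact (cell `b2b-bsdres`, team n1011, seat p10, row T-LOWKS)

HONEST FRAMING (cell `b2b-bsdres`, run/shared/lean/b2b/bsd-rank1-residual/, verbatim in every
file): the goal of the cell is to DELETE the COMBINATION-SHAPED residual classes of the
Birch–Swinnerton-Dyer formula for ALL analytic-rank `≤ 1` elliptic curves over `ℚ` — "full BSD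
formula for every rank `≤ 1` curve in class `C`" assembled STRICTLY from published theorems — so
that the rank-`≤ 1` remainder becomes exactly the CONSTRUCTION-SHAPED classes, which are TYPED
(missing-input `Prop`s), NOT attempted. This is not "finishing BSD". Team n1011: research route;
labels UNCHANGED; NOTHING booked. Theorems only; no definition, no named fact.

## Why

The lane's Heegner-point instruments (additive-p1's `HeegnerIndexRecords*`, the T-KOLY engine of
the lead's request Q7) report the `p`-adic valuation of the INDEX `[E(K) : ℤ y_K]`, while the typed
Kolyvagin facts of `KolyvaginShaStructure.lean` take `m₀` in McCallum's / Matar–Nekovář's printed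
form "`p^{m₀} ∥ y_K`" (`m₀ := sup{m | y_K ∈ p^m E(K)}`, MN19 §0.3). McCallum 1991, Lemma 5.1
(p. 303): *"`M_0 = ord_p[E(K) : ℤy_K]` … `ord_p[E(K) : ℤy_K] = max{M : y_K ∈ p^M E(K)}`"*. §1 proves
the underlying group-theoretic statement for ANY additive commutative group `A` without
`p`-torsion and any `P ∈ A` of infinite order with `[A : ℤP]` finite: `p^M ∣ [A : ℤP] ⟺ P ∈ p^M A`
(`⇐`: `[A : ℤ(p^M Q)] = p^M·[A : ℤQ]`, tree `X11b.index_zmultiples_zsmul`; `⇒`: induction, Cauchy's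
theorem in the finite quotient `A ⧸ ℤQ` and the absence of `p`-torsion). §2: the index form of the
Matar–Nekovář consumer (`E(K)[p] = 0` for `K` imaginary quadratic and `E[p]` irreducible: tree
`torsionBy_eq_bot_of_isImaginaryQuadratic_of_hasIrreducibleModPGaloisRep`).

References: McCallum 1991 [McCallumLMS1991] Lemma 5.1 (p. 303); Matar–Nekovář 2019
[MatarNekovar2019] §0.3, Thm. 0.7, §0.11; Miller 2011 [Miller2011LMS] Def. 1.1.
-/

noncomputable section

open scoped Classical

open WeierstrassCurve Literature.NumberTheory.EllipticCurves
  Literature.NumberTheory.EllipticCurves.ModularForms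
  Literature.NumberTheory.EllipticCurves.Rank1Residual
  Literature.NumberTheory.EllipticCurves.Rank1Residual.Typed

namespace Summit.BirchSwinnertonDyer.Rank1Residual.Additive

/-! ### §1 `p^M ∣ [A : ℤP] ⟺ P ∈ p^M A` (no `p`-torsion, `P` of infinite order, finite index) -/

section Group

variable {A : Type*} [AddCommGroup A] {p : ℕ}

/-- If `P = p^M Q` with `P` of infinite order then `p^M ∣ [A : ℤP]` (`[A : ℤ(p^M Q)] = p^M [A : ℤQ]`,
tree `X11b.index_zmultiples_zsmul`). McCallum 1991, Lemma 5.1 (bookkeeping). [cite: McCallumLMS1991, Lemma 5.1 (p. 303)] -/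
theorem pow_dvd_index_zmultiples_of_zsmul_eq {P Q : A} (hP : ¬ IsOfFinAddOrder P) {M : ℕ}
    (hQ : ((p ^ M : ℕ) : ℤ) • Q = P) : p ^ M ∣ (AddSubgroup.zmultiples P).index := by
  have hQinf : ¬ IsOfFinAddOrder Q := by
    intro h
    exact hP (by rw [← hQ]; exact h.zsmul)
  rw [← hQ, X11b.index_zmultiples_zsmul hQinf]
  exact ⟨_, by rw [Int.natAbs_natCast]⟩

/-- In a group without `p`-torsion, if `p ∣ [A : ℤQ]` (finite index) then `Q ∈ pA`: Cauchy's theorem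
gives `a ∉ ℤQ` with `pa = kQ`; `p ∣ k` would force `p(a − (k/p)Q) = 0`, so `p ∤ k`, and
`Q = (uk + sp)Q = p(ua + sQ)`. [cite: McCallumLMS1991, Lemma 5.1 (p. 303)] -/
theorem exists_zsmul_eq_of_prime_dvd_index (hp : p.Prime) (hA : ∀ a : A, (p : ℤ) • a = 0 → a = 0)
    {Q : A} (hidx : (AddSubgroup.zmultiples Q).index ≠ 0)
    (hdvd : p ∣ (AddSubgroup.zmultiples Q).index) : ∃ R : A, (p : ℤ) • R = Q := by
  haveI : Fact p.Prime := ⟨hp⟩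
  set H := AddSubgroup.zmultiples Q with hH
  haveI : H.FiniteIndex := ⟨hidx⟩
  haveI : Finite (A ⧸ H) := AddSubgroup.finite_quotient_of_finiteIndex
  letI : Fintype (A ⧸ H) := Fintype.ofFinite _
  have hcard : p ∣ Fintype.card (A ⧸ H) := by
    rwa [Fintype.card_eq_nat_card, ← AddSubgroup.index]
  obtain ⟨x, hx⟩ := exists_prime_addOrderOf_dvd_card p hcard
  obtain ⟨a, rfl⟩ := QuotientAddGroup.mk_surjective x
  -- `p • a ∈ H`, `a ∉ H`
  have hpa : (p : ℤ) • a ∈ H := by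
    rw [← QuotientAddGroup.eq_zero_iff, QuotientAddGroup.mk_zsmul, natCast_zsmul, ← hx]
    exact addOrderOf_nsmul_eq_zero _
  have ha : a ∉ H := by
    intro h
    have h0 : (QuotientAddGroup.mk a : A ⧸ H) = 0 := (QuotientAddGroup.eq_zero_iff a).mpr h
    rw [h0, addOrderOf_zero] at hx
    exact hp.one_lt.ne' hx.symm
  rw [hH, AddSubgroup.mem_zmultiples_iff] at hpa
  obtain ⟨k, hk⟩ := hpa
  -- `p ∤ k`
  have hpk : ¬ (p : ℤ) ∣ k := by
    rintro ⟨k₁, rfl⟩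
    have h1 : (p : ℤ) • (a - k₁ • Q) = 0 := by
      rw [zsmul_sub, ← hk, smul_smul]
      exact sub_self _
    have h2 : a - k₁ • Q = 0 := hA _ h1
    exact ha (by rw [sub_eq_zero.mp h2, hH]; exact AddSubgroup.zsmul_mem _ (AddSubgroup.mem_zmultiples Q) _)
  -- Bézout: `s p + u k = 1`
  have hirr : Irreducible (p : ℤ) := (Nat.prime_iff_prime_int.mp hp).irreducible
  obtain ⟨s, u, hus⟩ := (Irreducible.coprime_iff_not_dvd hirr).mpr hpk
  refine ⟨u • a + s • Q, ?_⟩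
  have hk' : (p : ℤ) • a = k • Q := hk.symm
  calc (p : ℤ) • (u • a + s • Q) = u • ((p : ℤ) • a) + (s * p) • Q := by
        rw [zsmul_add, smul_smul, smul_smul, mul_comm (p : ℤ) u, ← smul_smul, mul_comm (p : ℤ) s]
    _ = (s * p + u * k) • Q := by rw [hk', smul_smul, add_smul, add_comm]
    _ = Q := by rw [hus, one_smul]

/-- **`p^M ∣ [A : ℤP] ⟹ P ∈ p^M A`** (no `p`-torsion, `P` of infinite order, finite index), by
induction on `M`. McCallum 1991, Lemma 5.1: `ord_p[E(K) : ℤy_K] = max{M : y_K ∈ p^M E(K)}`.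
[cite: McCallumLMS1991, Lemma 5.1 (p. 303)] -/
theorem exists_zsmul_eq_of_pow_dvd_index (hp : p.Prime) (hA : ∀ a : A, (p : ℤ) • a = 0 → a = 0)
    {P : A} (hP : ¬ IsOfFinAddOrder P) (hidx : (AddSubgroup.zmultiples P).index ≠ 0) :
    ∀ {M : ℕ}, p ^ M ∣ (AddSubgroup.zmultiples P).index → ∃ Q : A, ((p ^ M : ℕ) : ℤ) • Q = P
  | 0, _ => ⟨P, by simp⟩
  | M + 1, hdvd => by
    obtain ⟨Q, hQ⟩ := exists_zsmul_eq_of_pow_dvd_index hp hA hP hidx ((pow_dvd_pow p M.le_succ).trans hdvd)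
    have hQinf : ¬ IsOfFinAddOrder Q := fun h ↦ hP (by rw [← hQ]; exact h.zsmul)
    -- `[A : ℤP] = p^M [A : ℤQ]`, so `p ∣ [A : ℤQ]`
    have hind : (AddSubgroup.zmultiples P).index = p ^ M * (AddSubgroup.zmultiples Q).index := by
      rw [← hQ, X11b.index_zmultiples_zsmul hQinf, Int.natAbs_natCast]
    have hidxQ : (AddSubgroup.zmultiples Q).index ≠ 0 := by
      intro h; exact hidx (by rw [hind, h, mul_zero])
    have hdvdQ : p ∣ (AddSubgroup.zmultiples Q).index := by
      have : p ^ M * p ∣ p ^ M * (AddSubgroup.zmultiples Q).index := by rw [← pow_succ, ← hind]; exact hdvd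
      exact (Nat.mul_dvd_mul_iff_left (pow_pos hp.pos M)).mp this
    obtain ⟨R, hR⟩ := exists_zsmul_eq_of_prime_dvd_index hp hA hidxQ hdvdQ
    refine ⟨R, ?_⟩
    rw [pow_succ, Nat.cast_mul, ← smul_smul, hR, hQ]

/-- **The index certificate `ord_p [A : ℤP] = m₀` in divisibility form:** `p^{m₀} ∥ P` in `A`
(no `p`-torsion, `P` of infinite order, finite index). [cite: McCallumLMS1991, Lemma 5.1 (p. 303)] -/
theorem zsmul_certificate_of_padicValNat_index (hp : p.Prime) (hA : ∀ a : A, (p : ℤ) • a = 0 → a = 0)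
    {P : A} (hP : ¬ IsOfFinAddOrder P) (hidx : (AddSubgroup.zmultiples P).index ≠ 0) {M₀ : ℕ}
    (hv : padicValNat p (AddSubgroup.zmultiples P).index = M₀) :
    (∃ Q : A, ((p ^ M₀ : ℕ) : ℤ) • Q = P) ∧ ¬ ∃ Q : A, ((p ^ (M₀ + 1) : ℕ) : ℤ) • Q = P := by
  haveI : Fact p.Prime := ⟨hp⟩
  refine ⟨exists_zsmul_eq_of_pow_dvd_index hp hA hP hidx ?_, ?_⟩
  · rw [← hv]; exact pow_padicValNat_dvd
  · rintro ⟨Q, hQ⟩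
    have hdvd := pow_dvd_index_zmultiples_of_zsmul_eq (p := p) hP hQ
    have := (padicValNat_dvd_iff_le hidx).mp hdvd
    omega

end Group

/-! ### §2 The index form of the Matar–Nekovář consumer -/

section IndexForm

variable {W : WeierstrassCurve ℚ} [W.IsElliptic] [W.IsGloballyMinimal] [NeZero (W.conductorNorm ℤ)]
  {K : Type} [Field K] [NumberField K] {p : ℕ} [hp : Fact p.Prime]
  {Dt : ModularParametrizationData W (W.conductorNorm ℤ)} {β : ℤ} {ι : K →+* ℂ}

/-- **`#Ш(E_K/K)[p^∞] = p^{2m₀}` from the INDEX certificate `ord_p [E(K) : ℤ y_K] = m₀`** (finite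
index, `y_K` of infinite order) and one non-divisible derived point, under irreducible `ρ̄_{E,p}`
(Matar–Nekovář Thm. 0.7 / §0.11, `hMN`): `E(K)[p] = 0` for `K` imaginary quadratic and `E[p]`
irreducible (tree), so §1 converts the index into `p^{m₀} ∥ y_K`.
[cite: MatarNekovar2019, Thm. 0.7 and §0.11 (pp. 456–457), §0.3] [cite: McCallumLMS1991, Lemma 5.1 (p. 303)] -/
theorem card_sha_primary_baseChange_eq_of_indexCertificate_of_irr
    (hMN : MatarNekovar2019_card_sha_primary_baseChange_of_derivedPoint_not_divisible_of_irreducible)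
    (hCM : ¬ W.HasCM) (hK : IsImaginaryQuadratic K) (hD3 : NumberField.discr K ≠ -3)
    (hD4 : NumberField.discr K ≠ -4) (hH : SatisfiesHeegnerHypothesis (W.conductorNorm ℤ) K)
    (hp2 : p ≠ 2) (hirr : W.HasIrreducibleModPGaloisRep p)
    (d₁ : KolyvaginHeegnerData Dt β ι 1) (P : (W.baseChange K).toAffine.Point)
    (hP : d₁.toGeomPoints d₁.derivedPoint = toGeomPoints (W.baseChange K) P)
    (hy : ¬ IsOfFinAddOrder P) (hidx : (AddSubgroup.zmultiples P).index ≠ 0) {M₀ : ℕ}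
    (hv : padicValNat p (AddSubgroup.zmultiples P).index = M₀)
    {ℓ : ℕ} (d : KolyvaginHeegnerData Dt β ι ℓ)
    (hℓ : Zhang2014.IsKolyvaginPrime (W.conductorNorm ℤ) W K p ℓ)
    (hPℓ : ¬ ∃ Q : (W.baseChange (ringClassField K ι ℓ)).toAffine.Point, (p : ℤ) • Q = d.derivedPoint) :
    Nat.card (AddCommGroup.primaryComponent (W.baseChange K).sha p) = p ^ (2 * M₀) := by
  have hA : ∀ a : (W.baseChange K).toAffine.Point, (p : ℤ) • a = 0 → a = 0 := by
    intro a ha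
    have hmem : a ∈ AddSubgroup.torsionBy (W.baseChange K).toAffine.Point (p : ℤ) :=
      (KolyvaginCocycle.mem_torsionBy_iff' (p : ℤ) a).mpr ha
    rw [torsionBy_eq_bot_of_isImaginaryQuadratic_of_hasIrreducibleModPGaloisRep W K hK hp.out hirr]
      at hmem
    exact (AddSubgroup.mem_bot).mp hmem
  obtain ⟨hdiv, hndiv⟩ := zsmul_certificate_of_padicValNat_index hp.out hA hy hidx hv
  exact hMN W hCM K hK hD3 hD4 hH p hp2 hirr Dt β ι d₁ P hP hy M₀ hdiv hndiv ℓ d hℓ hPℓ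

end IndexForm

/-! ### §3 The index form of the McCallum consumer (surjective `p`-adic image): the `E`/`E^{(d_K)}`
split from `ord_p [E(K) : ℤ y_K] = m₀` and one non-divisible derived point -/

section IndexFormSplit

variable {W : WeierstrassCurve ℚ} [W.IsElliptic] [W.IsGloballyMinimal] [NeZero (W.conductorNorm ℤ)]
  {K : Type} [Field K] [NumberField K] {p : ℕ} [hp : Fact p.Prime]
  {Dt : ModularParametrizationData W (W.conductorNorm ℤ)} {β : ℤ} {ι : K →+* ℂ}

/-- **`#Ш(E/ℚ)[p^∞] = p^{2m₀}` in analytic rank `0` from the INDEX certificate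
`ord_p [E(K) : ℤ y_K] = m₀` and one Kolyvagin prime with `P_ℓ ∉ pE(K_ℓ)`** (McCallum's theorem in the
Lemma-5.1 form, fact `McCallum1991_card_sha_primary_of_derivedPoint_not_divisible_indexForm` = `hKS`;
`ρ̄_{E,p^n}` onto ∀ `n`; `E(K)[p] = 0` by irreducibility; §1 converts the index).
[cite: McCallumLMS1991, §1 Theorem (Kolyvagin) (p. 296), Lemma 5.1 (p. 303), Thm. 5.4 (p. 308)] -/
theorem card_sha_primary_eq_of_indexCertificate
    (hKS : McCallum1991_card_sha_primary_of_derivedPoint_not_divisible_indexForm)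
    (hCM : ¬ W.HasCM) (hK : IsImaginaryQuadratic K) (hD3 : NumberField.discr K ≠ -3)
    (hD4 : NumberField.discr K ≠ -4) (hH : SatisfiesHeegnerHypothesis (W.conductorNorm ℤ) K)
    (hp2 : p ≠ 2) (htower : ∀ n : ℕ, W.HasSurjectiveModNGaloisRep (p ^ n : ℕ))
    (hr : W.analyticRank = 0)
    (d₁ : KolyvaginHeegnerData Dt β ι 1) (P : (W.baseChange K).toAffine.Point)
    (hP : d₁.toGeomPoints d₁.derivedPoint = toGeomPoints (W.baseChange K) P)
    (hy : ¬ IsOfFinAddOrder P) (hidx : (AddSubgroup.zmultiples P).index ≠ 0) {M₀ : ℕ}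
    (hv : padicValNat p (AddSubgroup.zmultiples P).index = M₀)
    {ℓ : ℕ} (d : KolyvaginHeegnerData Dt β ι ℓ)
    (hℓ : Zhang2014.IsKolyvaginPrime (W.conductorNorm ℤ) W K p ℓ)
    (hPℓ : ¬ ∃ Q : (W.baseChange (ringClassField K ι ℓ)).toAffine.Point, (p : ℤ) • Q = d.derivedPoint) :
    Nat.card (AddCommGroup.primaryComponent W.sha p) = p ^ (2 * M₀) := by
  haveI : NeZero (p : ℚ) := ⟨Nat.cast_ne_zero.mpr hp.out.ne_zero⟩
  have hsurj : W.HasSurjectiveModNGaloisRep (p : ℤ) := by simpa using htower 1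
  have hirr : W.HasIrreducibleModPGaloisRep p :=
    hasIrreducibleModPGaloisRep_of_hasSurjectiveModNGaloisRep W p hsurj
  have hA : ∀ a : (W.baseChange K).toAffine.Point, (p : ℤ) • a = 0 → a = 0 := by
    intro a ha
    have hmem : a ∈ AddSubgroup.torsionBy (W.baseChange K).toAffine.Point (p : ℤ) :=
      (KolyvaginCocycle.mem_torsionBy_iff' (p : ℤ) a).mpr ha
    rw [torsionBy_eq_bot_of_isImaginaryQuadratic_of_hasIrreducibleModPGaloisRep W K hK hp.out hirr]
      at hmem
    exact (AddSubgroup.mem_bot).mp hmem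
  obtain ⟨hdiv, hndiv⟩ := zsmul_certificate_of_padicValNat_index hp.out hA hy hidx hv
  haveI : (W.quadraticTwist (NumberField.discr K : ℚ)).IsElliptic :=
    W.isElliptic_quadraticTwist (by exact_mod_cast NumberField.discr_ne_zero K)
  have hw : W.rootNumber = 1 := rootNumber_eq_one_of_even_analyticRank (by rw [hr]; exact ⟨0, rfl⟩)
  exact ((hKS W hCM K hK hD3 hD4 hH p hp2 htower Dt β ι d₁ P hP hy M₀ hdiv hndiv ℓ d hℓ hPℓ
    (W.quadraticTwist (NumberField.discr K : ℚ)) ⟨1, one_smul _ _⟩).2.1 hw).1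

/-- **`BSD(E,p)` in analytic rank `0` from the INDEX certificate, one non-divisible derived point and
`ord_p #Ш_an = 2m₀`** — the shape the lane's Heegner-index instruments + B-18 `KOLY-DERIV1@3` deliver;
class-agnostic, ANY reduction at `p`. [cite: McCallumLMS1991, §1 Theorem (Kolyvagin) (p. 296), Lemma 5.1 (p. 303)]
[cite: Miller2011LMS, §1 and Def. 1.1] -/
theorem bsdp_of_indexCertificate_of_derivedPoint
    (hKS : McCallum1991_card_sha_primary_of_derivedPoint_not_divisible_indexForm)
    (hGZK : rank_eq_analyticRank_of_analyticRank_le_one)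
    (hCM : ¬ W.HasCM) (hK : IsImaginaryQuadratic K) (hD3 : NumberField.discr K ≠ -3)
    (hD4 : NumberField.discr K ≠ -4) (hH : SatisfiesHeegnerHypothesis (W.conductorNorm ℤ) K)
    (hp2 : p ≠ 2) (htower : ∀ n : ℕ, W.HasSurjectiveModNGaloisRep (p ^ n : ℕ))
    (hr : W.analyticRank = 0)
    (d₁ : KolyvaginHeegnerData Dt β ι 1) (P : (W.baseChange K).toAffine.Point)
    (hP : d₁.toGeomPoints d₁.derivedPoint = toGeomPoints (W.baseChange K) P)
    (hy : ¬ IsOfFinAddOrder P) (hidx : (AddSubgroup.zmultiples P).index ≠ 0) {M₀ : ℕ}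
    (hv : padicValNat p (AddSubgroup.zmultiples P).index = M₀)
    {ℓ : ℕ} (d : KolyvaginHeegnerData Dt β ι ℓ)
    (hℓ : Zhang2014.IsKolyvaginPrime (W.conductorNorm ℤ) W K p ℓ)
    (hPℓ : ¬ ∃ Q : (W.baseChange (ringClassField K ι ℓ)).toAffine.Point, (p : ℤ) • Q = d.derivedPoint)
    {q : ℚ} (hq : shaAn W = (q : ℂ)) (hvq : padicValRat p q = ((2 * M₀ : ℕ) : ℤ)) : BSDp W p := by
  haveI : Finite W.sha := (hGZK W (by rw [hr]; exact zero_le_one)).2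
  refine bsdp_of_missingPPartAt W p hGZK (by rw [hr]; exact zero_le_one) ⟨q, hq, ?_⟩
  rw [WeierstrassCurve.shaOrder, ← padicValNat_card_addPrimaryComponent (A := W.sha) p,
    card_sha_primary_eq_of_indexCertificate hKS hCM hK hD3 hD4 hH hp2 htower hr d₁ P hP hy hidx hv d
      hℓ hPℓ, padicValNat.prime_pow]
  exact_mod_cast hvq

/-- **The LOWER half from the index certificate** (`ord_p #Ш_an ≤ 2m₀`).
[cite: McCallumLMS1991, §1 Theorem (Kolyvagin) (p. 296), Lemma 5.1 (p. 303)] [cite: Miller2011LMS, Def. 1.1] -/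
theorem missingLowerBoundAt_of_indexCertificate_of_derivedPoint
    (hKS : McCallum1991_card_sha_primary_of_derivedPoint_not_divisible_indexForm)
    (hGZK : rank_eq_analyticRank_of_analyticRank_le_one)
    (hCM : ¬ W.HasCM) (hK : IsImaginaryQuadratic K) (hD3 : NumberField.discr K ≠ -3)
    (hD4 : NumberField.discr K ≠ -4) (hH : SatisfiesHeegnerHypothesis (W.conductorNorm ℤ) K)
    (hp2 : p ≠ 2) (htower : ∀ n : ℕ, W.HasSurjectiveModNGaloisRep (p ^ n : ℕ))
    (hr : W.analyticRank = 0)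
    (d₁ : KolyvaginHeegnerData Dt β ι 1) (P : (W.baseChange K).toAffine.Point)
    (hP : d₁.toGeomPoints d₁.derivedPoint = toGeomPoints (W.baseChange K) P)
    (hy : ¬ IsOfFinAddOrder P) (hidx : (AddSubgroup.zmultiples P).index ≠ 0) {M₀ : ℕ}
    (hv : padicValNat p (AddSubgroup.zmultiples P).index = M₀)
    {ℓ : ℕ} (d : KolyvaginHeegnerData Dt β ι ℓ)
    (hℓ : Zhang2014.IsKolyvaginPrime (W.conductorNorm ℤ) W K p ℓ)
    (hPℓ : ¬ ∃ Q : (W.baseChange (ringClassField K ι ℓ)).toAffine.Point, (p : ℤ) • Q = d.derivedPoint)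
    {q : ℚ} (hq : shaAn W = (q : ℂ)) (hvq : padicValRat p q ≤ ((2 * M₀ : ℕ) : ℤ)) :
    MissingLowerBoundAt W p := by
  haveI : Finite W.sha := (hGZK W (by rw [hr]; exact zero_le_one)).2
  refine ⟨q, hq, ?_⟩
  rw [WeierstrassCurve.shaOrder, ← padicValNat_card_addPrimaryComponent (A := W.sha) p,
    card_sha_primary_eq_of_indexCertificate hKS hCM hK hD3 hD4 hH hp2 htower hr d₁ P hP hy hidx hv d
      hℓ hPℓ, padicValNat.prime_pow]
  exact_mod_cast hvq

end IndexFormSplit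

/-! ## §4 Two-fact forms: the index-form fact is DERIVED (harvest-2 E71), and the review flags

Harvest seat 2 (GEN 31, E71; `Literature/…/KolyvaginShaStructureIndexFormProofs.lean`, p251683)
proved in the kernel that the index-form fact `hKS` of §3 FOLLOWS from the two other facts of
`KolyvaginShaStructure.lean` — McCallum's `E(K₁)`-form (`h₁`) and the Matar–Nekovář total-order
form (`h₂`) — by comparing the two total orders `p^{2M₀} = p^{2M₁}` (Mordell–Weil over `K₁` gives
McCallum's `M₁ = ord_p(P₁)`), WITHOUT the Lemma-5.1 injection `E(K)/p^M ↪ E(K₁)/p^M`. The three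
theorems below are the §3 consumers fed with `…_indexForm_of_matarNekovar h₁ h₂`: a certificate
record then names the two PRIMARY facts and never the variant.

REVIEW FLAGS carried by every consumer of this file and of `X4RankZeroLowerKolyvaginDerived[Irr]`
(cell referee 1, ACK-1 T-LOWKS 2026-08-21T05:51Z, proviso 1; harvest-2 E69/E71):
`McCallum91-eigenspace-dictionary` (the `±`-eigenspace ↔ `E`/`E^{(d_K)}` identification,
`ε = −w(E/ℚ)`: `(ℤ/p^{M₀})²` on the analytic-rank-ZERO member, `0` on the rank-ONE member),
`McCallum91-padic-image` (the image hypothesis is typed as the `p`-ADIC tower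
`∀ n, ρ_{E,p^n}` onto — weaker than print), and, whenever `h₂` is used (§2, §4, the `Irr` file),
`MN19-0.7-0.11-structure-composite` + `Kolyvagin1991-LNM1479-primary-unread`. O8 / EXOTIC rows
(additive `p`, `ρ̄_{E,p}` not onto): Cha 2005 Thm. 21 requires `ℓ ∤ D` and good or multiplicative
reduction at `ℓ`, so it does NOT cover an additive `p`; on those rows Matar–Nekovář §0.11 is the
SOLE printed warrant (harvest-2 E69 §E). INSTRUMENT: the certificate inputs (`k = ord_p[E(K):ℤy_K]`,
one Kolyvagin prime `ℓ` with `P_ℓ ∉ pE(K_ℓ)`) are EVIDENCE produced off the hub by the lane's engine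
of record B-18 `KOLY-DERIV1@3` (two-engine rule R5 before any row is called closed); nothing here
asserts that any certificate exists.
-/

section TwoFacts

variable {W : WeierstrassCurve ℚ} [W.IsElliptic] [W.IsGloballyMinimal] [NeZero (W.conductorNorm ℤ)]
  {K : Type} [Field K] [NumberField K] {p : ℕ} [hp : Fact p.Prime]
  {Dt : ModularParametrizationData W (W.conductorNorm ℤ)} {β : ℤ} {ι : K →+* ℂ}

/-- **`#Ш(E/ℚ)[p^∞] = p^{2m₀}` in analytic rank `0` from the INDEX certificate, over the two PRIMARY
facts** (McCallum `E(K₁)`-form `h₁` + Matar–Nekovář `h₂`; the index form is derived from them by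
`McCallum1991_card_sha_primary_of_derivedPoint_not_divisible_indexForm_of_matarNekovar`).
[cite: McCallumLMS1991, §1 Theorem (Kolyvagin) (p. 296), Thm. 5.4 (p. 308)]
[cite: MatarNekovar2019, Thm. 0.7 and §0.11 (pp. 456–457)] -/
theorem card_sha_primary_eq_of_indexCertificate_of_matarNekovar
    (h₁ : McCallum1991_card_sha_primary_of_derivedPoint_not_divisible)
    (h₂ : MatarNekovar2019_card_sha_primary_baseChange_of_derivedPoint_not_divisible_of_irreducible)
    (hCM : ¬ W.HasCM) (hK : IsImaginaryQuadratic K) (hD3 : NumberField.discr K ≠ -3)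
    (hD4 : NumberField.discr K ≠ -4) (hH : SatisfiesHeegnerHypothesis (W.conductorNorm ℤ) K)
    (hp2 : p ≠ 2) (htower : ∀ n : ℕ, W.HasSurjectiveModNGaloisRep (p ^ n : ℕ))
    (hr : W.analyticRank = 0)
    (d₁ : KolyvaginHeegnerData Dt β ι 1) (P : (W.baseChange K).toAffine.Point)
    (hP : d₁.toGeomPoints d₁.derivedPoint = toGeomPoints (W.baseChange K) P)
    (hy : ¬ IsOfFinAddOrder P) (hidx : (AddSubgroup.zmultiples P).index ≠ 0) {M₀ : ℕ}
    (hv : padicValNat p (AddSubgroup.zmultiples P).index = M₀)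
    {ℓ : ℕ} (d : KolyvaginHeegnerData Dt β ι ℓ)
    (hℓ : Zhang2014.IsKolyvaginPrime (W.conductorNorm ℤ) W K p ℓ)
    (hPℓ : ¬ ∃ Q : (W.baseChange (ringClassField K ι ℓ)).toAffine.Point, (p : ℤ) • Q = d.derivedPoint) :
    Nat.card (AddCommGroup.primaryComponent W.sha p) = p ^ (2 * M₀) :=
  card_sha_primary_eq_of_indexCertificate
    (McCallum1991_card_sha_primary_of_derivedPoint_not_divisible_indexForm_of_matarNekovar h₁ h₂)
    hCM hK hD3 hD4 hH hp2 htower hr d₁ P hP hy hidx hv d hℓ hPℓ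

/-- **`BSD(E,p)` in analytic rank `0` from the INDEX certificate and `ord_p #Ш_an(E) = 2m₀`, over
the two PRIMARY facts.** [cite: McCallumLMS1991, §1 Theorem (Kolyvagin) (p. 296), Thm. 5.4 (p. 308)]
[cite: MatarNekovar2019, Thm. 0.7 and §0.11 (pp. 456–457)] [cite: Miller2011LMS, §1 and Def. 1.1] -/
theorem bsdp_of_indexCertificate_of_matarNekovar
    (h₁ : McCallum1991_card_sha_primary_of_derivedPoint_not_divisible)
    (h₂ : MatarNekovar2019_card_sha_primary_baseChange_of_derivedPoint_not_divisible_of_irreducible)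
    (hGZK : rank_eq_analyticRank_of_analyticRank_le_one)
    (hCM : ¬ W.HasCM) (hK : IsImaginaryQuadratic K) (hD3 : NumberField.discr K ≠ -3)
    (hD4 : NumberField.discr K ≠ -4) (hH : SatisfiesHeegnerHypothesis (W.conductorNorm ℤ) K)
    (hp2 : p ≠ 2) (htower : ∀ n : ℕ, W.HasSurjectiveModNGaloisRep (p ^ n : ℕ))
    (hr : W.analyticRank = 0)
    (d₁ : KolyvaginHeegnerData Dt β ι 1) (P : (W.baseChange K).toAffine.Point)
    (hP : d₁.toGeomPoints d₁.derivedPoint = toGeomPoints (W.baseChange K) P)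
    (hy : ¬ IsOfFinAddOrder P) (hidx : (AddSubgroup.zmultiples P).index ≠ 0) {M₀ : ℕ}
    (hv : padicValNat p (AddSubgroup.zmultiples P).index = M₀)
    {ℓ : ℕ} (d : KolyvaginHeegnerData Dt β ι ℓ)
    (hℓ : Zhang2014.IsKolyvaginPrime (W.conductorNorm ℤ) W K p ℓ)
    (hPℓ : ¬ ∃ Q : (W.baseChange (ringClassField K ι ℓ)).toAffine.Point, (p : ℤ) • Q = d.derivedPoint)
    {q : ℚ} (hq : shaAn W = (q : ℂ)) (hvq : padicValRat p q = ((2 * M₀ : ℕ) : ℤ)) : BSDp W p :=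
  bsdp_of_indexCertificate_of_derivedPoint
    (McCallum1991_card_sha_primary_of_derivedPoint_not_divisible_indexForm_of_matarNekovar h₁ h₂)
    hGZK hCM hK hD3 hD4 hH hp2 htower hr d₁ P hP hy hidx hv d hℓ hPℓ hq hvq

/-- **The LOWER half from the INDEX certificate, over the two PRIMARY facts** (`ord_p #Ш_an ≤ 2m₀`).
[cite: McCallumLMS1991, §1 Theorem (Kolyvagin) (p. 296), Thm. 5.4 (p. 308)]
[cite: MatarNekovar2019, Thm. 0.7 and §0.11 (pp. 456–457)] [cite: Miller2011LMS, Def. 1.1] -/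
theorem missingLowerBoundAt_of_indexCertificate_of_matarNekovar
    (h₁ : McCallum1991_card_sha_primary_of_derivedPoint_not_divisible)
    (h₂ : MatarNekovar2019_card_sha_primary_baseChange_of_derivedPoint_not_divisible_of_irreducible)
    (hGZK : rank_eq_analyticRank_of_analyticRank_le_one)
    (hCM : ¬ W.HasCM) (hK : IsImaginaryQuadratic K) (hD3 : NumberField.discr K ≠ -3)
    (hD4 : NumberField.discr K ≠ -4) (hH : SatisfiesHeegnerHypothesis (W.conductorNorm ℤ) K)
    (hp2 : p ≠ 2) (htower : ∀ n : ℕ, W.HasSurjectiveModNGaloisRep (p ^ n : ℕ))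
    (hr : W.analyticRank = 0)
    (d₁ : KolyvaginHeegnerData Dt β ι 1) (P : (W.baseChange K).toAffine.Point)
    (hP : d₁.toGeomPoints d₁.derivedPoint = toGeomPoints (W.baseChange K) P)
    (hy : ¬ IsOfFinAddOrder P) (hidx : (AddSubgroup.zmultiples P).index ≠ 0) {M₀ : ℕ}
    (hv : padicValNat p (AddSubgroup.zmultiples P).index = M₀)
    {ℓ : ℕ} (d : KolyvaginHeegnerData Dt β ι ℓ)
    (hℓ : Zhang2014.IsKolyvaginPrime (W.conductorNorm ℤ) W K p ℓ)
    (hPℓ : ¬ ∃ Q : (W.baseChange (ringClassField K ι ℓ)).toAffine.Point, (p : ℤ) • Q = d.derivedPoint)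
    {q : ℚ} (hq : shaAn W = (q : ℂ)) (hvq : padicValRat p q ≤ ((2 * M₀ : ℕ) : ℤ)) :
    MissingLowerBoundAt W p :=
  missingLowerBoundAt_of_indexCertificate_of_derivedPoint
    (McCallum1991_card_sha_primary_of_derivedPoint_not_divisible_indexForm_of_matarNekovar h₁ h₂)
    hGZK hCM hK hD3 hD4 hH hp2 htower hr d₁ P hP hy hidx hv d hℓ hPℓ hq hvq

end TwoFacts

end Summit.BirchSwinnertonDyer.Rank1Residual.Additive

end
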